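import Literature.IUT.LogVolume.ThetaFieldReading
import Literature.IUT.LogVolume.Corollary22ThetaFieldExists
import HarnessLib

/-!
# `Cor22.IsSubThetaField`: non-vacuity at every point of `U_X`, and the degree divisibility it yields

[IUTchIV] Cor. 2.2 (ii), p. 42: "`F := F_tpd(√−1, E_{F_tpd}[3·5])`". abc-iut-S-d1's `Cor22.exists_isThetaField` constructs,
for every `λ ∈ U_X(F_tpd)`, print's field `F_E` inside `F̄_tpd` as a number field satisfying abc-iut-S-d2's `IsThetaField P F`;
by `IsSubThetaField.of_isThetaField` (ThetaFieldReading.lean) that field satisfies the v3 pinning predicate of the Θ-volume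
datum. So the pinning clause of `Cor22.ThetaVolumeDatumAt` (v3) is satisfiable at every point by a field STRICTLY bigger than
`F_tpd` (it contains `√−1` and the `15`-torsion coordinates); the intended inhabitant `F‡(P) ⊇ F_E` is abc-iut-L5-t7's.
Also (appended): `IsSubThetaField.finrank_dvd` — `[F : F_tpd] ∣ [L : F_tpd]` for every finite `L ⊇ F_tpd` in which the
generators' minimal polynomials split (tower law along the embedding `F ↪ L` of `IsSubThetaField.nonempty_algHom`); at
`L = F‡(P)` this is the divisibility form of [IUTchIV] Thm. 1.10 Step (ii)'s degree bound for the datum's field (p. 24,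
(E3)–(E5)). Proof-only; classical; TAKES NO SIDE on anything disputed. [cite: Mochizuki2012, IUTchIV Cor. 2.2 (ii) p. 42] (claim key,
disputed).
-/

noncomputable section

namespace Literature.IUT.LogVolume

namespace Cor22

open Literature.NumberTheory.DiophantineGeometry.GenEll

/-- **Non-vacuity of the v3 pinning predicate**: for `λ ∈ U_X(F_tpd)` there is a number field `F ⊆ F̄_tpd` over `F_tpd` with
`IsSubThetaField P F` — namely print's `F_E = F_tpd(√−1, E_λ[3·5])` (abc-iut-S-d1's `exists_isThetaField`), which even satisfies
S-d2's stronger `IsThetaField P F`. [cite: Mochizuki2012, IUTchIV Cor. 2.2 (ii) p. 42] -/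
theorem exists_isSubThetaField {P : NFPoint} (hU : P.InU) :
    ∃ F : IntermediateField P.F (AlgebraicClosure P.F), ∃ _ : NumberField F,
      IsThetaField P F ∧ IsSubThetaField P F := by
  obtain ⟨F, hNF, hF⟩ := exists_isThetaField (P := P) hU
  exact ⟨F, hNF, hF, IsSubThetaField.of_isThetaField hF⟩

/-- **`[F : F_tpd] ∣ [L : F_tpd]`** for a field `F` with `IsSubThetaField P F` and any finite `L ⊇ F_tpd` splitting the
minimal polynomials of the admissible generators (e.g. `L = F‡(P)`): the tower law along the `F_tpd`-embedding `F ↪ L`.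
Sharpens `IsSubThetaField.finrank_le`. [cite: Mochizuki2012, IUTchIV Thm. 1.10 proof Step (ii) p. 24] -/
theorem IsSubThetaField.finrank_dvd {P : NFPoint} {F : Type} [Field F] [NumberField F] [Algebra P.F F]
    (h : IsSubThetaField P F) {L : Type*} [Field L] [Algebra P.F L] [FiniteDimensional P.F L]
    (hL : ∀ x ∈ subThetaFieldGenerators P F,
      IsIntegral P.F x ∧ ((minpoly P.F x).map (algebraMap P.F L)).Splits) :
    Module.finrank P.F F ∣ Module.finrank P.F L := by
  obtain ⟨φ⟩ := h.nonempty_algHom hL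
  letI : Algebra F L := φ.toRingHom.toAlgebra
  haveI : IsScalarTower P.F F L := IsScalarTower.of_algebraMap_eq fun x => (φ.commutes x).symm
  exact Dvd.intro _ (Module.finrank_mul_finrank P.F F L)

end Cor22

end Literature.IUT.LogVolume

end
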